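import Summits.KontsevichZagierPeriods.KontsevichZagierPeriods.Theorems.PentagonInKZ.Negative.EvalInstance

/-!
# `PentagonInKZ` (stmt-KontsevichZagierPeriods-11348) — negative knowledge, part 2: load-bearing hypotheses

Each `PentagonInKZWithout<H>` below is the crux `FurushoPentagon.PentagonInKZ` VERBATIM with one
hypothesis deleted, and each is FALSE; `PentagonInKZNoSign` is the crux with the sign
`(-1)^{#X₁(W)}` of the series dropped, also FALSE.  So any proof of the crux must use: H1 (`χ`
kills the moves) — witness the point-evaluation character `χ_{1/3}([σ,f]) = f(1/3,…,1/3)`,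
additive, multiplicative, unital, breaking the weight-3 pentagon identity (`27/2 ≠ 27/4`); H2
(multiplicativity) — witness `χ = -eval` (`c_∅ = -1`, `c_∅² ≠ c_∅³`); the assignment of `Z` on
admissible indices — witness `Z ≡ 2[pt,1]`, and even its `u = []` instance alone (it pins
`c_∅ = 1`); the sign — at `χ = eval` the sign-less series would give `ζ(3) + ζ(2,1) = 0`.
(H3, non-degeneracy, is believed dispensable: idempotent splitting; not treated here.)
[cite: Furusho2003, Prop. 3.2.3; Furusho2011, §2]
-/

noncomputable section

open Literature.NumberTheory.Transcendental

namespace Summit.KontsevichZagierPeriods.FurushoPentagon.PentagonInKZNegative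

open Summit.KontsevichZagierPeriods.KontsevichZagierPeriods.Theses.FurushoPentagon (PentagonInKZ)

/-! ## §4 Load-bearing hypotheses: any proof must use H2 and the assignment `Z` -/


/-- **H2 is load-bearing**: `χ = -eval` is additive, kills the relations and takes the value `1`
(at `-[pt,1]`), but its series has constant term `-1` and `(-1)² ≠ (-1)³`. [folklore] -/
theorem not_pentagonInKZWithoutMul :
    ¬ (∀ (R : Type) [CommRing R] [Algebra ℚ R] (χ : KZ.FormalRep →+ R),
        (∀ c ∈ KZ.relations, χ c = 0) → (∃ u, χ u = 1) →
        ∀ Z : List ℕ → KZ.FormalRep, AgreesWithSimplex Z → NCSeries.DrinfeldPentagon (cruxSeries R χ Z)) := by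
  intro h
  have hrel : ∀ c ∈ KZ.relations, (-KZ.eval) c = 0 := fun c hc => by
    simp [eval_rel c hc]
  have hunit : ∃ u, (-KZ.eval) u = 1 :=
    ⟨-KZ.of KZ.IntegralRep.unit, by rw [AddMonoidHom.neg_apply, map_neg, eval_of_unit, neg_neg]⟩
  have hp := sq_eq_cube_of_pentagon (h ℝ (-KZ.eval) hrel hunit simplexZ simplexZ_agrees)
  rw [cruxSeries_nil, agrees_nil simplexZ_agrees, AddMonoidHom.neg_apply, eval_of_unit] at hp
  norm_num at hp


/-- **The assignment hypothesis is load-bearing**: with `Z ≡ 2[pt,1]` the constant term is `2` and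
`4 ≠ 8`. [folklore] -/
theorem not_pentagonInKZWithoutZ :
    ¬ (∀ (R : Type) [CommRing R] [Algebra ℚ R] (χ : KZ.FormalRep →+ R),
        (∀ c ∈ KZ.relations, χ c = 0) → (∀ a b, χ (a * b) = χ a * χ b) → (∃ u, χ u = 1) →
        ∀ Z : List ℕ → KZ.FormalRep, NCSeries.DrinfeldPentagon (cruxSeries R χ Z)) := by
  intro h
  have hp := sq_eq_cube_of_pentagon (h ℝ KZ.eval eval_rel KZ.eval_mul' ⟨_, eval_of_unit⟩
    (fun _ => KZ.of KZ.IntegralRep.unit + KZ.of KZ.IntegralRep.unit))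
  rw [cruxSeries_nil, map_add, eval_of_unit] at hp
  norm_num at hp


/-- **Even the `u = []` instance of the assignment hypothesis is load-bearing** (it is what pins
the constant term `c_∅ = χ[pt,1] = 1`): keep the simplex classes on non-empty indices and put
`Z [] := 2[pt,1]`. [folklore] -/
theorem not_pentagonInKZWithoutZNil :
    ¬ (∀ (R : Type) [CommRing R] [Algebra ℚ R] (χ : KZ.FormalRep →+ R),
        (∀ c ∈ KZ.relations, χ c = 0) → (∀ a b, χ (a * b) = χ a * χ b) → (∃ u, χ u = 1) →
        ∀ Z : List ℕ → KZ.FormalRep, (∀ (u : List ℕ) (hu : MZV.IsAdmissible u), u ≠ [] →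
          Z u = KZ.of (KZ.mzvRep u hu (KZ.mzvIntegrand_isSemialgebraicFunOn_holds u)
            (KZ.mzvIntegrand_integrableOn_holds u hu))) →
        NCSeries.DrinfeldPentagon (cruxSeries R χ Z)) := by
  intro h
  classical
  let Z : List ℕ → KZ.FormalRep := fun u =>
    if u = [] then KZ.of KZ.IntegralRep.unit + KZ.of KZ.IntegralRep.unit else simplexZ u
  have hZ : ∀ (u : List ℕ) (hu : MZV.IsAdmissible u), u ≠ [] →
      Z u = KZ.of (KZ.mzvRep u hu (KZ.mzvIntegrand_isSemialgebraicFunOn_holds u)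
        (KZ.mzvIntegrand_integrableOn_holds u hu)) := fun u hu hne => by
    simp only [Z, if_neg hne]
    exact simplexZ_agrees u hu
  have hp := sq_eq_cube_of_pentagon (h ℝ KZ.eval eval_rel KZ.eval_mul' ⟨_, eval_of_unit⟩ Z hZ)
  rw [cruxSeries_nil] at hp
  simp only [Z, if_true, map_add, eval_of_unit] at hp
  norm_num at hp

/-! ## §9 A refuted variant: the sign `(-1)^{#X₁}` is load-bearing -/

/-- The crux series WITHOUT the sign `(-1)^{#X₁(W)}`. [folklore] -/
def cruxSeriesNoSign (R : Type) [CommRing R] [Algebra ℚ R] (χ : KZ.FormalRep →+ R)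
    (Z : List ℕ → KZ.FormalRep) : NCSeries Bool R :=
  fun W : List Bool => (MZV.shuffleReg W).sum (fun v a => a • (if MZV.IsConvergentWord v then
      χ (Z (MZV.ofBinaryWord v)) else (0 : R)))

/-- Relation with the signed series. [folklore] -/
theorem cruxSeries_eq_sign_mul (R : Type) [CommRing R] [Algebra ℚ R] (χ : KZ.FormalRep →+ R)
    (Z : List ℕ → KZ.FormalRep) (W : List Bool) :
    cruxSeries R χ Z W = (-1 : R) ^ (W.count true) * cruxSeriesNoSign R χ Z W := rfl

/-- And conversely. [folklore] -/
theorem cruxSeriesNoSign_eq (R : Type) [CommRing R] [Algebra ℚ R] (χ : KZ.FormalRep →+ R)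
    (Z : List ℕ → KZ.FormalRep) (W : List Bool) :
    cruxSeriesNoSign R χ Z W = (-1 : R) ^ (W.count true) * cruxSeries R χ Z W := by
  rw [cruxSeries_eq_sign_mul, ← mul_assoc, ← mul_pow, neg_mul_neg, one_mul, one_pow, one_mul]


/-- **The sign-less variant is FALSE**: at `χ = eval` its weight-3 content would be
`ζ(3) + ζ(2,1) = 0`, but multiple zeta values are positive. [cite: Furusho2003, Prop. 3.2.3 (the sign (-1)^{dp W})] -/
theorem not_pentagonInKZNoSign :
    ¬ (∀ (R : Type) [CommRing R] [Algebra ℚ R] (χ : KZ.FormalRep →+ R),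
        (∀ c ∈ KZ.relations, χ c = 0) → (∀ a b, χ (a * b) = χ a * χ b) → (∃ u, χ u = 1) →
        ∀ Z : List ℕ → KZ.FormalRep, AgreesWithSimplex Z →
          NCSeries.DrinfeldPentagon (cruxSeriesNoSign R χ Z)) := by
  intro h
  have hp := h ℝ KZ.eval eval_rel KZ.eval_mul' ⟨_, eval_of_unit⟩ simplexZ simplexZ_agrees
  have h0 : cruxSeriesNoSign ℝ KZ.eval simplexZ [] = 1 := by
    rw [cruxSeriesNoSign_eq, cruxSeries_nil_eq_one _ _ isRealisation_eval simplexZ_agrees]; simp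
  have hx : cruxSeriesNoSign ℝ KZ.eval simplexZ [false] = 0 := by
    rw [cruxSeriesNoSign_eq, cruxSeries_x]; simp
  have hy : cruxSeriesNoSign ℝ KZ.eval simplexZ [true] = 0 := by
    rw [cruxSeriesNoSign_eq, cruxSeries_y]; simp
  have h3 := NCSeries.DrinfeldPentagon.apply_weight_three hp h0 hx hy
  rw [cruxSeriesNoSign_eq, cruxSeriesNoSign_eq, cruxSeries_xxy, cruxSeries_xyy,
    simplexZ_agrees [3] (by decide), simplexZ_agrees [2, 1] (by decide), KZ.eval_of, KZ.eval_of,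
    KZ.mzvRep_value_holds, KZ.mzvRep_value_holds] at h3
  have p3 := multipleZeta_pos_of_isAdmissible_holds (s := [3]) (by decide)
  have p21 := multipleZeta_pos_of_isAdmissible_holds (s := [2, 1]) (by decide)
  norm_num at h3
  linarith

/-! ## §10 H1 (killing the moves) is load-bearing: the point-evaluation character -/

/-- **The point-evaluation character** `χ_a([σ, f]) := f(a, …, a)`: additive and multiplicative
(Fubini integrands multiply pointwise), unital, but NOT move-invariant. [folklore] -/
def pointChar (a : ℝ) : KZ.FormalRep →+ ℝ :=
  FreeAbelianGroup.lift fun r : Σ n, KZ.IntegralRep n => r.2.integrand fun _ => a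

/-- `χ_a [σ, f] = f(a,…,a)`. [folklore] -/
@[simp] theorem pointChar_of (a : ℝ) {n : ℕ} (r : KZ.IntegralRep n) :
    pointChar a (KZ.of r) = r.integrand fun _ => a :=
  FreeAbelianGroup.lift_apply_of _ _

/-- `χ_a` is multiplicative on generators. [folklore] -/
theorem pointChar_of_mul_of (a : ℝ) {n m : ℕ} (r : KZ.IntegralRep n) (s : KZ.IntegralRep m) :
    pointChar a (KZ.of r * KZ.of s) = pointChar a (KZ.of r) * pointChar a (KZ.of s) := by
  rw [KZ.of_mul_of, pointChar_of, pointChar_of, pointChar_of, KZ.IntegralRep.prod_integrand_eq,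
    KZ.IntegralRep.prodFun_apply]

/-- **`χ_a` is multiplicative** for the Fubini product. [folklore] -/
theorem pointChar_mul (a : ℝ) (c d : KZ.FormalRep) :
    pointChar a (c * d) = pointChar a c * pointChar a d := by
  induction c using FreeAbelianGroup.induction_on with
  | zero => simp
  | of x =>
    induction d using FreeAbelianGroup.induction_on with
    | zero => simp
    | of y => exact pointChar_of_mul_of a x.2 y.2
    | neg y ih => rw [mul_neg, map_neg, map_neg, ih, mul_neg]
    | add y z hy hz => rw [mul_add, map_add, map_add, hy, hz, mul_add]
  | neg x ih => rw [neg_mul, map_neg, map_neg, ih, neg_mul]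
  | add x y hx hy => rw [add_mul, map_add, map_add, hx, hy, add_mul]

/-- `χ_a [pt, 1] = 1`. [folklore] -/
theorem pointChar_unit (a : ℝ) : pointChar a (KZ.of KZ.IntegralRep.unit) = 1 := by
  rw [pointChar_of]; rfl

/-- `χ_a ⟦ζ(3)⟧ = a⁻¹ · a⁻¹ · (1-a)⁻¹` (the integrand `ω₀ω₀ω₁` at the diagonal point). [cite: KontsevichZagier2001, §1.1] -/
theorem pointChar_Z3 (a : ℝ) : pointChar a (simplexZ [3]) = 1 / a * (1 / a) * (1 / (1 - a)) := by
  rw [simplexZ_agrees [3] (by decide), pointChar_of]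
  show KZ.mzvIntegrand [3] (fun _ => a) = _
  have hw : MZV.binaryWord [3] = [false, false, true] := by decide
  unfold KZ.mzvIntegrand
  rw [hw]
  show ∏ i : Fin 3, KZ.mzvForm ([false, false, true].getD i false) a = _
  simp [Fin.prod_univ_succ, KZ.mzvForm]
  ring

/-- `χ_a ⟦ζ(2,1)⟧ = a⁻¹ · (1-a)⁻¹ · (1-a)⁻¹`. [cite: KontsevichZagier2001, §1.1] -/
theorem pointChar_Z21 (a : ℝ) :
    pointChar a (simplexZ [2, 1]) = 1 / a * (1 / (1 - a)) * (1 / (1 - a)) := by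
  rw [simplexZ_agrees [2, 1] (by decide), pointChar_of]
  show KZ.mzvIntegrand [2, 1] (fun _ => a) = _
  have hw : MZV.binaryWord [2, 1] = [false, true, true] := by decide
  unfold KZ.mzvIntegrand
  rw [hw]
  show ∏ i : Fin 3, KZ.mzvForm ([false, true, true].getD i false) a = _
  simp [Fin.prod_univ_succ, KZ.mzvForm]
  ring


/-- **H1 is load-bearing**: the point-evaluation character at `a = 1/3` is additive,
multiplicative and unital, yet its series violates the weight-3 pentagon identity
(`27/2 ≠ 27/4`): `χ_{1/3}⟦ζ(3)⟧ = 27/2`, `χ_{1/3}⟦ζ(2,1)⟧ = 27/4`.  (At `a = 1/2` weight 3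
passes — the diagonal point does not see duality there.) [folklore] -/
theorem not_pentagonInKZWithoutRel :
    ¬ (∀ (R : Type) [CommRing R] [Algebra ℚ R] (χ : KZ.FormalRep →+ R),
        (∀ a b, χ (a * b) = χ a * χ b) → (∃ u, χ u = 1) →
        ∀ Z : List ℕ → KZ.FormalRep, AgreesWithSimplex Z → NCSeries.DrinfeldPentagon (cruxSeries R χ Z)) := by
  intro h
  have hp := h ℝ (pointChar (1 / 3)) (pointChar_mul _) ⟨_, pointChar_unit _⟩ simplexZ simplexZ_agrees
  have h0 : cruxSeries ℝ (pointChar (1 / 3)) simplexZ [] = 1 := by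
    rw [cruxSeries_nil, agrees_nil simplexZ_agrees, pointChar_unit]
  have h3 := NCSeries.DrinfeldPentagon.apply_weight_three hp h0 (cruxSeries_x _ _) (cruxSeries_y _ _)
  rw [cruxSeries_xxy, cruxSeries_xyy, pointChar_Z3, pointChar_Z21] at h3
  norm_num at h3


end Summit.KontsevichZagierPeriods.FurushoPentagon.PentagonInKZNegative
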